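import Summits.CriticalPhenomena.PercolationContinuityZ3.Theorems.PercNearOneGluingNoHeavyLowerTailSunflowerGradedTBernScheme
import Summits.CriticalPhenomena.PercolationContinuityZ3.Theorems.PercNearOneGluingNoHeavyLowerTailSunflowerGradedTBernEndgame
import Summits.CriticalPhenomena.PercolationContinuityZ3.Theorems.PercNearOneGluingNoHeavyLowerTailSunflowerTBernHubPackH
import Summits.CriticalPhenomena.PercolationContinuityZ3.Theorems.PercNearOneGluingNoHeavyLowerTailSunflowerTBernMerge
import HarnessLib

/-!
# `NoHeavyLowerTail` (crux stmt-CriticalPhenomena-4575), abstract sunflower cubic: GRADED T-BERN — the certificate `DomG` for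
# ALIGNED families and for {hub, x-type pack, last γ-heavy petal} families (the endgame of the reduction)

Support file (seat `prim-ineq-prove-1` gen 69; `--supports stmt-CriticalPhenomena-4575`).  No `sorry`, no named facts, no
definitions.  Memo: run/shared/lean/prim/prim-ineq-prove-1/FINDING-GRADED-prove1-g69.md §2–§3.

Normalised coordinates (`…SunflowerTBernZOne`, `…SunflowerTBernHubPackH`): `α_j = A_j/A₀ = 1 + κ(x_j − 1)`, `x_j = u_j/b`,
`γ_j = g_j/a₀`; the model certificate `DomG` is the normalised one scaled back (`domG_of_normalised`: every model factor is
`C a₀ · (normalised factor)∘(A₀/a₀ · X)`).  A STATE for a sub-family `F₀` is `∏_{F₀}(α_jX+γ_j) ≤_coef (X+1)^(|F₀|−1)(A′X + G′)`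
with `G′ = ∏γ_j` exact; the last step of `…SunflowerGradedTBernEndgame` turns a state (+ a last γ-heavy petal) into `DomG`
(`domG_of_state0`, `domG_of_state_r`).  States are supplied by
* `coefDom_prodPoly_aligned` for ALIGNED families (all petals γ-heavy, or all γ-light — the latter is every family when
  `s = 0`): **`domG_of_aligned`**;
* `zone_extend_flex` (hub singleton + γ-heavy x-type petals) in the sequel `…SunflowerGradedTBernHubPack`
  (`domG_hub_pack`, `domG_hub_pack_r`).
-/

noncomputable section

namespace Summit.CriticalPhenomena.PercolationContinuityZ3.Theorems.SunflowerPartition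

namespace SafeCalc

namespace LinkedCurrency

open Finset Polynomial

variable {ι : Type*}

/-! ## Scaling: normalised certificates give `DomG` -/

/-- Scaling `X ↦ rX` and multiplying by a nonnegative constant preserves coefficientwise domination. [this work] -/
theorem coefDom_scale {p q : ℝ[X]} (h : CoefDom p q) {c r : ℝ} (hc : 0 ≤ c) (hr : 0 ≤ r) :
    CoefDom (C c * p.comp (C r * X)) (C c * q.comp (C r * X)) := by
  intro k
  rw [coeff_C_mul, coeff_C_mul, comp_C_mul_X_coeff, comp_C_mul_X_coeff]
  exact mul_le_mul_of_nonneg_left (mul_le_mul_of_nonneg_right (h k) (pow_nonneg hr k)) hc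

/-- A model factor is `C a₀ ·` (its normalisation) `∘ ((A₀/a₀)X)`. [this work] -/
theorem lin_eq_scale {A₀ a₀ : ℝ} (hA₀ : A₀ ≠ 0) (ha₀ : a₀ ≠ 0) (A g : ℝ) :
    C A * X + C g = C a₀ * (C (A / A₀) * X + C (g / a₀)).comp (C (A₀ / a₀) * X) := by
  rw [add_comp, mul_comp, C_comp, C_comp, X_comp, mul_add, ← mul_assoc, ← mul_assoc, ← C_mul, ← C_mul, ← C_mul]
  have e1 : a₀ * (A / A₀) * (A₀ / a₀) = A := by field_simp
  have e2 : a₀ * (g / a₀) = g := by field_simp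
  rw [e1, e2]

/-- The model family polynomial is `C a₀^|t| ·` (the normalised one) `∘ ((A₀/a₀)X)`. [this work] -/
theorem prodPoly_eq_scale [DecidableEq ι] {A₀ a₀ : ℝ} (hA₀ : A₀ ≠ 0) (ha₀ : a₀ ≠ 0) (t : Finset ι) (A g : ι → ℝ) :
    prodPoly t A g = C (a₀ ^ t.card) * (prodPoly t (fun j => A j / A₀) (fun j => g j / a₀)).comp (C (A₀ / a₀) * X) := by
  unfold prodPoly
  rw [Polynomial.prod_comp, C_pow, ← prod_const, ← prod_mul_distrib]
  exact prod_congr rfl fun j _ => lin_eq_scale hA₀ ha₀ (A j) (g j)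

/-- **Bridge (normalised → `DomG`).**  If `∏_t(α_jX + γ_j)·((1/A₀)X + x/a₀) ≤_coef (X+1)^(|t|−1)((1/A₀)X + 1)((1/A₀)X + 1/a₀)`
for the normalised family, then `DomG s b β x t u vv m` (`t` nonempty, `A₀, a₀ > 0`). [this work] -/
theorem domG_of_normalised [DecidableEq ι] {s b β x : ℝ} (hA₀ : 0 < s + (1 - s) * b) (ha₀ : 0 < (1 - s) * b + s * β)
    {t : Finset ι} (ht : t.Nonempty) {u vv m : ι → ℝ}
    (h : CoefDom (prodPoly t (fun j => (s + (1 - s) * u j) / (s + (1 - s) * b))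
          (fun j => ((1 - s) * m j + s * vv j) / ((1 - s) * b + s * β)) *
          (C (1 / (s + (1 - s) * b)) * X + C (x / ((1 - s) * b + s * β))))
      ((C 1 * X + C 1) ^ (t.card - 1) *
        ((C (1 / (s + (1 - s) * b)) * X + C 1) * (C (1 / (s + (1 - s) * b)) * X + C (1 / ((1 - s) * b + s * β)))))) :
    DomG s b β x t u vv m := by
  set A₀ := s + (1 - s) * b with hA₀d
  set a₀ := (1 - s) * b + s * β with ha₀d
  have hA₀ne := hA₀.ne'
  have ha₀ne := ha₀.ne'
  unfold DomG
  have hn : t.card - 1 + 2 = t.card + 1 := by have := ht.card_pos; omega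
  -- rewrite every model factor as a scaled normalised factor
  rw [prodPoly_eq_scale hA₀ne ha₀ne t, lin_eq_scale hA₀ne ha₀ne 1 x, lin_eq_scale hA₀ne ha₀ne A₀ a₀,
    lin_eq_scale hA₀ne ha₀ne 1 a₀, lin_eq_scale (A₀ := A₀) hA₀ne ha₀ne 1 1, div_self hA₀ne, div_self ha₀ne]
  set q : ℝ[X] := C (A₀ / a₀) * X with hq
  have key := coefDom_scale h (pow_nonneg ha₀.le (t.card + 1)) (div_nonneg hA₀.le ha₀.le)
  refine (key.of_eq_left ?_).of_eq_right ?_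
  · rw [mul_comp, C_pow, C_pow, pow_succ]; ring
  · rw [mul_comp, mul_comp, pow_comp, C_pow, ← hn]; ring

/-! ## The normalisation dictionary (shared hypotheses of the state lemmas) -/

/-- From a state to `DomG` (no last petal): `∏_t(α_jX+γ_j) ≤_coef (X+1)^(|t|−1)(A′X + ∏γ_j)` with `A′ ≤ 1/A₀` gives `DomG`
for an `AdmissibleG` family (`x ∈ [a₀, 1]`). [this work] -/
theorem domG_of_state0 [DecidableEq ι] {s b β x : ℝ} (hb : 0 < b) (hbβ : b ≤ β) (hs0 : 0 ≤ s) (hs1 : s ≤ 1)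
    (hax : (1 - s) * b + s * β ≤ x) (hx1 : x ≤ 1) {t : Finset ι} (ht : t.Nonempty) {u vv m : ι → ℝ}
    (hadm : AdmissibleG s b β x t u vv m) {A' : ℝ} (hA' : A' ≤ 1 / (s + (1 - s) * b))
    (hdom : CoefDom (prodPoly t (fun j => (s + (1 - s) * u j) / (s + (1 - s) * b))
        (fun j => ((1 - s) * m j + s * vv j) / ((1 - s) * b + s * β)))
      ((C 1 * X + C 1) ^ (t.card - 1) *
        (C A' * X + C (∏ j ∈ t, ((1 - s) * m j + s * vv j) / ((1 - s) * b + s * β))))) :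
    DomG s b β x t u vv m := by
  obtain ⟨hub, hu1, hvβ, -, hmb, -, -, -, -, hpg⟩ := hadm
  have hs' : 0 ≤ 1 - s := sub_nonneg.2 hs1
  set A₀ := s + (1 - s) * b with hA₀d
  set a₀ := (1 - s) * b + s * β with ha₀d
  have hβ : 0 < β := hb.trans_le hbβ
  have hb1 : b ≤ 1 := by obtain ⟨j, hj⟩ := ht; exact (hub j hj).trans (hu1 j hj)
  have hA₀ : 0 < A₀ := by
    have : 0 ≤ s * (1 - b) := mul_nonneg hs0 (sub_nonneg.2 hb1)
    have e : A₀ = b + s * (1 - b) := by rw [hA₀d]; ring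
    rw [e]; linarith
  have ha₀ : 0 < a₀ := by
    have : 0 ≤ s * (β - b) := mul_nonneg hs0 (sub_nonneg.2 hbβ)
    have e : a₀ = b + s * (β - b) := by rw [ha₀d]; ring
    rw [e]; linarith
  have hx0 : 0 ≤ x := ha₀.le.trans hax
  -- the normalised block product
  set G' := ∏ j ∈ t, ((1 - s) * m j + s * vv j) / a₀ with hG'd
  have hG'x : G' * x ≤ 1 := by
    rw [hG'd, prod_div_distrib, prod_const, div_mul_eq_mul_div, div_le_one (pow_pos ha₀ _)]; exact hpg
  have hG'0 : 0 ≤ G' := by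
    rw [hG'd]; exact prod_nonneg fun j hj => div_nonneg (add_nonneg (mul_nonneg hs' (hb.le.trans (hmb j hj)))
      (mul_nonneg hs0 (hβ.le.trans (hvβ j hj)))) ha₀.le
  have hG'a : a₀ * G' ≤ 1 := by nlinarith
  have hfin := coefDom_final0 (A' := A') ha₀ hA₀ hA' hG'a hx0 hx1 hG'x
  have hph : CoefNonneg (C (1 / A₀) * X + C (x / a₀)) := coefNonneg_lin (by positivity) (by positivity)
  have hfl : CoefNonneg ((C (1 : ℝ) * X + C 1) ^ (t.card - 1)) := (coefNonneg_lin zero_le_one zero_le_one).pow _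
  refine domG_of_normalised hA₀ ha₀ ht ?_
  refine ((hdom.mul_right hph).trans ?_)
  rw [mul_assoc]
  exact hfin.mul_left hfl

/-- From a state to `DomG` (with a last γ-heavy petal `r`): a state `(A′, ∏_{t∖r}γ)` for `t.erase r` with
`A′·α_r ≤ 1/A₀`, `0 ≤ A′`, and `a₀A_r ≤ A₀g_r`, gives `DomG` for the `AdmissibleG` family on `t` (`x ∈ [a₀,1]`, `β ≤ 1`).
[this work] -/
theorem domG_of_state_r [DecidableEq ι] {s b β x : ℝ} (hb : 0 < b) (hbβ : b ≤ β) (hβ1 : β ≤ 1) (hs0 : 0 ≤ s)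
    (hs1 : s ≤ 1) (hax : (1 - s) * b + s * β ≤ x) {t : Finset ι} {u vv m : ι → ℝ}
    (hadm : AdmissibleG s b β x t u vv m) {r : ι} (hr : r ∈ t) (ht : (t.erase r).Nonempty)
    (hheavy : ((1 - s) * b + s * β) * (s + (1 - s) * u r) ≤ (s + (1 - s) * b) * ((1 - s) * m r + s * vv r))
    {A' : ℝ} (hA'0 : 0 ≤ A') (hA' : A' * ((s + (1 - s) * u r) / (s + (1 - s) * b)) ≤ 1 / (s + (1 - s) * b))
    (hdom : CoefDom (prodPoly (t.erase r) (fun j => (s + (1 - s) * u j) / (s + (1 - s) * b))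
        (fun j => ((1 - s) * m j + s * vv j) / ((1 - s) * b + s * β)))
      ((C 1 * X + C 1) ^ ((t.erase r).card - 1) *
        (C A' * X + C (∏ j ∈ t.erase r, ((1 - s) * m j + s * vv j) / ((1 - s) * b + s * β))))) :
    DomG s b β x t u vv m := by
  obtain ⟨hub, hu1, hvβ, hv1, hmb, hmu, hmv, -, -, hpg⟩ := hadm
  have hs' : 0 ≤ 1 - s := sub_nonneg.2 hs1
  set A₀ := s + (1 - s) * b with hA₀d
  set a₀ := (1 - s) * b + s * β with ha₀d
  have hβ : 0 < β := hb.trans_le hbβ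
  have hb1 : b ≤ 1 := (hub r hr).trans (hu1 r hr)
  have hA₀ : 0 < A₀ := by
    have : 0 ≤ s * (1 - b) := mul_nonneg hs0 (sub_nonneg.2 hb1)
    have e : A₀ = b + s * (1 - b) := by rw [hA₀d]; ring
    rw [e]; linarith
  have ha₀ : 0 < a₀ := by
    have : 0 ≤ s * (β - b) := mul_nonneg hs0 (sub_nonneg.2 hbβ)
    have e : a₀ = b + s * (β - b) := by rw [ha₀d]; ring
    rw [e]; linarith
  have haA : a₀ ≤ A₀ := by rw [ha₀d, hA₀d]; nlinarith [mul_le_mul_of_nonneg_left hβ1 hs0]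
  set αf : ι → ℝ := fun j => (s + (1 - s) * u j) / A₀ with hαf
  set γf : ι → ℝ := fun j => ((1 - s) * m j + s * vv j) / a₀ with hγf
  have hγ1 : ∀ j ∈ t, 1 ≤ γf j := fun j hj => by
    rw [hγf]; refine (one_le_div ha₀).2 ?_
    have := mul_le_mul_of_nonneg_left (hmb j hj) hs'
    have := mul_le_mul_of_nonneg_left (hvβ j hj) hs0
    rw [ha₀d]; linarith
  -- the last petal
  have hαr1 : 1 ≤ αf r := by
    rw [hαf]; refine (one_le_div hA₀).2 ?_
    have := mul_le_mul_of_nonneg_left (hub r hr) hs'; rw [hA₀d]; linarith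
  have hαγr : αf r ≤ γf r := by rw [hαf, hγf, div_le_div_iff₀ hA₀ ha₀]; linarith
  have hγAr : a₀ * γf r ≤ A₀ * αf r := by
    rw [hαf, hγf, mul_div_cancel₀ _ ha₀.ne', mul_div_cancel₀ _ hA₀.ne']
    nlinarith [mul_le_mul_of_nonneg_left (hmu r hr) hs', mul_le_mul_of_nonneg_left (hv1 r hr) hs0]
  -- the block product
  set G' := ∏ j ∈ t.erase r, γf j with hG'd
  have hG'1 : 1 ≤ G' := Pendant.one_le_prod_of_one_le _ fun j hj => hγ1 j (mem_of_mem_erase hj)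
  have hbud : G' * γf r * x ≤ 1 := by
    have e : G' * γf r = ∏ j ∈ t, γf j := by rw [hG'd, mul_comm, mul_prod_erase t γf hr]
    rw [e, hγf, prod_div_distrib, prod_const, div_mul_eq_mul_div, div_le_one (pow_pos ha₀ _)]; exact hpg
  have hfin := coefDom_final_r ha₀ haA hA'0 hA' hG'1 hαr1 hαγr hγAr hax hbud
  -- assemble: `∏_t = ℓ_r · ∏_{t∖r}`
  have hph : CoefNonneg (C (1 / A₀) * X + C (x / a₀)) :=
    coefNonneg_lin (by positivity) (div_nonneg (ha₀.le.trans hax) ha₀.le)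
  have hlr : CoefNonneg (C (αf r) * X + C (γf r)) :=
    coefNonneg_lin (zero_le_one.trans hαr1) (zero_le_one.trans ((hγ1 r hr)))
  have hfl : CoefNonneg ((C (1 : ℝ) * X + C 1) ^ ((t.erase r).card - 1)) := (coefNonneg_lin zero_le_one zero_le_one).pow _
  have hrt : r ∉ t.erase r := notMem_erase r t
  have htne : t.Nonempty := ⟨r, hr⟩
  have hcard : t.card - 1 = ((t.erase r).card - 1) + 1 := by
    rw [card_erase_of_mem hr]; have := ht.card_pos; rw [card_erase_of_mem hr] at this; omega
  refine domG_of_normalised hA₀ ha₀ htne ?_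
  rw [← insert_erase hr, prodPoly_insert hrt, insert_erase hr, hcard, pow_succ]
  have step1 : CoefDom ((C (αf r) * X + C (γf r)) * prodPoly (t.erase r) αf γf * (C (1 / A₀) * X + C (x / a₀)))
      ((C (αf r) * X + C (γf r)) * ((C 1 * X + C 1) ^ ((t.erase r).card - 1) * (C A' * X + C G')) *
        (C (1 / A₀) * X + C (x / a₀))) := (hdom.mul_left hlr).mul_right hph
  refine step1.trans ?_
  have step2 := hfin.mul_left hfl
  refine (step2.of_eq_left ?_).of_eq_right ?_
  · ring
  · ring

/-! ## Aligned families -/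

/-- **`DomG` for ALIGNED families**: every petal γ-heavy (`a₀A_j ≤ A₀g_j`), or every petal γ-light (`A₀g_j ≤ a₀A_j`, e.g. all
families when `s = 0`).  Parameters `0 < b ≤ β`, `0 ≤ s ≤ 1`, `x ∈ [a₀, 1]`. [this work] -/
theorem domG_of_aligned [DecidableEq ι] {s b β x : ℝ} (hb : 0 < b) (hbβ : b ≤ β) (hs0 : 0 ≤ s) (hs1 : s ≤ 1)
    (hax : (1 - s) * b + s * β ≤ x) (hx1 : x ≤ 1) {t : Finset ι} (ht : t.Nonempty) {u vv m : ι → ℝ}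
    (hadm : AdmissibleG s b β x t u vv m)
    (hal : (∀ j ∈ t, ((1 - s) * b + s * β) * (s + (1 - s) * u j) ≤ (s + (1 - s) * b) * ((1 - s) * m j + s * vv j)) ∨
      (∀ j ∈ t, (s + (1 - s) * b) * ((1 - s) * m j + s * vv j) ≤ ((1 - s) * b + s * β) * (s + (1 - s) * u j))) :
    DomG s b β x t u vv m := by
  obtain ⟨hub, hu1, hvβ, -, hmb, -, -, hpu, -, -⟩ := id hadm
  have hs' : 0 ≤ 1 - s := sub_nonneg.2 hs1
  set A₀ := s + (1 - s) * b with hA₀d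
  set a₀ := (1 - s) * b + s * β with ha₀d
  have hβ : 0 < β := hb.trans_le hbβ
  have hb1 : b ≤ 1 := by obtain ⟨j, hj⟩ := ht; exact (hub j hj).trans (hu1 j hj)
  have hA₀ : 0 < A₀ := by
    have : 0 ≤ s * (1 - b) := mul_nonneg hs0 (sub_nonneg.2 hb1)
    have e : A₀ = b + s * (1 - b) := by rw [hA₀d]; ring
    rw [e]; linarith
  have ha₀ : 0 < a₀ := by
    have : 0 ≤ s * (β - b) := mul_nonneg hs0 (sub_nonneg.2 hbβ)
    have e : a₀ = b + s * (β - b) := by rw [ha₀d]; ring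
    rw [e]; linarith
  set κ := (1 - s) * b / A₀ with hκ
  have hκ0 : 0 ≤ κ := div_nonneg (mul_nonneg hs' hb.le) hA₀.le
  have hκ1 : κ ≤ 1 := by rw [hκ, div_le_one hA₀, hA₀d]; linarith
  set xf : ι → ℝ := fun j => u j / b with hxd
  set αf : ι → ℝ := fun j => (s + (1 - s) * u j) / A₀ with hαd
  set γf : ι → ℝ := fun j => ((1 - s) * m j + s * vv j) / a₀ with hγd
  have hx : ∀ j ∈ t, 1 ≤ xf j := fun j hj => by rw [hxd]; exact (one_le_div hb).2 (hub j hj)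
  have hα : ∀ j, αf j = 1 + κ * (xf j - 1) := by
    intro j; rw [hαd, hκ, hxd]; field_simp; rw [hA₀d]; ring
  have hα1 : ∀ j ∈ t, 1 ≤ αf j := fun j hj => by
    rw [hα]; have := mul_nonneg hκ0 (sub_nonneg.2 (hx j hj)); linarith
  have hγ1 : ∀ j ∈ t, 1 ≤ γf j := fun j hj => by
    rw [hγd]; refine (one_le_div ha₀).2 ?_
    have := mul_le_mul_of_nonneg_left (hmb j hj) hs'
    have := mul_le_mul_of_nonneg_left (hvβ j hj) hs0
    rw [ha₀d]; linarith
  have hal' : (∀ j ∈ t, γf j ≤ αf j) ∨ (∀ j ∈ t, αf j ≤ γf j) := by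
    rcases hal with h | h
    · right; intro j hj; rw [hαd, hγd, div_le_div_iff₀ hA₀ ha₀]; have := h j hj; linarith
    · left; intro j hj; rw [hαd, hγd, div_le_div_iff₀ ha₀ hA₀]; have := h j hj; linarith
  have key := coefDom_prodPoly_aligned t ht αf γf hα1 hγ1 hal'
  -- `∏α ≤ α(∏x) ≤ 1/A₀`
  have hX : ∏ j ∈ t, xf j ≤ 1 / b := by
    rw [hxd, prod_div_distrib, prod_const, div_le_div_iff₀ (pow_pos hb _) hb, one_mul]
    calc (∏ j ∈ t, u j) * b ≤ b ^ (t.card - 1) * b := mul_le_mul_of_nonneg_right hpu hb.le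
      _ = b ^ t.card := by rw [← pow_succ]; congr 1; have := ht.card_pos; omega
  have hαprod : ∏ j ∈ t, αf j ≤ 1 / A₀ := by
    obtain ⟨h1, _⟩ := prod_alpha_le hκ0 hκ1 t hx
    have e : ∏ j ∈ t, αf j = ∏ j ∈ t, (1 + κ * (xf j - 1)) := prod_congr rfl fun j _ => hα j
    rw [e]
    refine h1.trans ?_
    have h2 : 1 + κ * (∏ j ∈ t, xf j - 1) ≤ 1 + κ * (1 / b - 1) := by
      have := mul_le_mul_of_nonneg_left (sub_le_sub_right hX 1) hκ0; linarith
    have h3 : 1 + κ * (1 / b - 1) = 1 / A₀ := by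
      rw [hκ, eq_div_iff hA₀.ne']
      have e1 : (1 + (1 - s) * b / A₀ * (1 / b - 1)) * A₀ = A₀ + (1 - s) * b * (1 / b - 1) := by field_simp
      have e2 : (1 - s) * b * (1 / b - 1) = (1 - s) * (1 - b) := by field_simp
      rw [e1, e2, hA₀d]; ring
    linarith
  exact domG_of_state0 hb hbβ hs0 hs1 hax hx1 ht hadm hαprod key

end LinkedCurrency

end SafeCalc

end Summit.CriticalPhenomena.PercolationContinuityZ3.Theorems.SunflowerPartition
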